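/-
Copyright (c) 2026. All rights reserved.
Released under Apache 2.0 license as described in the file LICENSE.
-/
import Mathlib
import HarnessLib
import Literature.Topology.FourManifolds.CircleLoopConcat

/-!
# The drag loop of a circle around a 2-sphere and its inserted class

Topic `Literature/Topology/FourManifolds`. Module G3 of the proof of
`Literature.Topology.FourManifolds.exists_middleLevel_isStabilization_of_isHCobordism` (Kirby 1989,
Ch. X pp. 55–56, odd case: *drag the attaching circle of a 2-handle around a 2-sphere on which
`w₂ ≠ 0` to change the framing*), continuing `CircleLoopClasses.lean` (G) and
`CircleLoopConcat.lean` (G2).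

For a disc `D : 𝔻² → M` with boundary circle `γ` and a sphere map `g : 𝕊² → M` we write down an
explicit loop of circles `dragLoop D g p₀ p` based at `γ` (a continuous annulus `ℝ × 𝕊¹ → M`
starting and ending on `γ`): inward through `D`, along a path `p₀` to the north-pole value of `g`,
outward through the upper hemisphere disc of `g` to its equator circle `ε`, then the loop
`sphereLoop g p` at `ε` (inward through the upper hemisphere, along a path `p` from the north-pole
value to the south-pole value, outward through the lower hemisphere), and back.  The main result
`eClass_insertDisc_dragLoop_add` computes the class this loop inserts in front of `D`:

  `e(F, insert (dragLoop) D) + e(F, D) = e(Fε, discUp g) + e(Fε, discDown g)`,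

so by the gluing criterion of `StableFramesAlongDiscs.lean` the class changes exactly when `g`
carries no stable tangent framing (`eClass_insertDisc_dragLoop_ne`).  Ingredients: families of
discs with fixed boundary (§1), radial reparametrisations (§2: reading a disc inward and capping
gives back its class, §4), annuli of constant circles along paths insert the trivial class (§5),
the computation at the equator (§6) and conjugation invariance (§7).

Everything is proved; no named facts are introduced.

## References

* R. C. Kirby, *The topology of 4-manifolds*, LNM 1374 (1989), Ch. X, pp. 55–56. [Kirby1989]
-/

noncomputable section

open Set Function Metric Topology Bundle Filter
open scoped Topology Manifold ContDiff unitInterval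

namespace Literature.Topology.FourManifolds

namespace StableFrames

/-- Local notation: `𝔼 n` is the model Euclidean space `EuclideanSpace ℝ (Fin n)`. -/
local notation "𝔼 " n:arg => EuclideanSpace ℝ (Fin n)

/-- Local notation: the unit circle. -/
local notation "𝕊¹" => (sphere (0 : EuclideanSpace ℝ (Fin (1 + 1))) 1)

/-- Local notation: the closed unit disc in the plane. -/
local notation "𝔻²" => UnitDisc2

/-- Local notation: the unit `2`-sphere. -/
local notation "𝕊²" => (sphere (0 : EuclideanSpace ℝ (Fin (2 + 1))) 1)

variable {m : ℕ} {M : Type*} [TopologicalSpace M] [ChartedSpace (𝔼 m) M] [IsManifold (𝓡 m) 1 M]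

/-! ### 1. Families of discs with a fixed boundary; constant discs -/

section Families

/-- **Discs moving with a fixed boundary circle have the same extension class.** [folklore] -/
theorem eClass_eq_of_family (hm : 2 ≤ m) {γ : 𝕊¹ → M} (D : I → C(𝔻², M))
    (hDc : Continuous fun p : I × 𝔻² => D p.1 p.2) (hbd : ∀ s u, D s (bd u) = γ u)
    {F : 𝕊¹ → Fr m} (hF : IsStableFrameFieldOn γ F univ) :
    eClass (D 0) F (hF.congr_map fun u _ => hbd 0 u) = eClass (D 1) F (hF.congr_map fun u _ => hbd 1 u) := by
  have hfr := (framed_glue_iff_of_family (m := m) (D₁ := fun _ => D 0) (D₂ := fun s => D s)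
    ((D 0).continuous.comp continuous_snd) hDc fun s u => (hbd 0 u).trans (hbd s u).symm).mp
    (framed_glue_self hm (D 0))
  exact (framed_glue_iff hm (D 0) (D 1) _ _).mp hfr

/-- A constant frame along a constant map is a stable frame field. [folklore] -/
theorem isStableFrameFieldOn_constMap {X : Type*} [TopologicalSpace X] (x : M) {A : Fr m} (hA : LinearIndependent ℝ A)
    (S : Set X) : IsStableFrameFieldOn (fun _ : X => x) (fun _ => A) S :=
  ⟨fun _ => continuousOn_const, fun _ => continuousOn_const, fun _ _ => hA⟩

omit [ChartedSpace (𝔼 m) M] [IsManifold (𝓡 m) 1 M] in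
/-- The constant disc. [folklore] -/
def constDisc (x : M) : C(𝔻², M) := ContinuousMap.const 𝔻² x

/-- **The constant disc has class `0` for a constant frame.** [folklore] -/
theorem eClass_constDisc (hm : 2 ≤ m) (x : M) {A : Fr m} (hA : LinearIndependent ℝ A) :
    eClass (constDisc x) (fun _ => A) (isStableFrameFieldOn_constMap x hA univ) = 0 :=
  eClass_bd hm (G := fun _ : 𝔻² => A) (isStableFrameFieldOn_constMap x hA (univ : Set 𝔻²))

end Families

/-! ### 2. Radial reparametrisations by a profile -/

section Reparam

omit [ChartedSpace (𝔼 m) M] [IsManifold (𝓡 m) 1 M]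

/-- **Radial reparametrisation of the disc by the profile `h`**: `x ↦ h(‖x‖) x/‖x‖` (the centre
is fixed since `h(0)/0 = 0` in Lean's conventions, and in the applications `h(0) = 0`). [folklore] -/
def radialReparam (h : ℝ → ℝ) (x : 𝔻²) : EuclideanSpace ℝ (Fin (1 + 1)) :=
  (h ‖(x : EuclideanSpace ℝ (Fin (1 + 1)))‖ / ‖(x : EuclideanSpace ℝ (Fin (1 + 1)))‖) • (x : EuclideanSpace ℝ (Fin (1 + 1)))

/-- The norm of the reparametrised point is `|h(‖x‖)|` off the centre. [folklore] -/
theorem norm_radialReparam {h : ℝ → ℝ} {x : 𝔻²} (hx : (x : EuclideanSpace ℝ (Fin (1 + 1))) ≠ 0) :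
    ‖radialReparam h x‖ = |h ‖(x : EuclideanSpace ℝ (Fin (1 + 1)))‖| := by
  rw [radialReparam, norm_smul, norm_div, norm_norm, Real.norm_eq_abs, div_mul_cancel₀ _ (norm_ne_zero_iff.mpr hx)]

/-- The norm of the reparametrised point is at most `|h(‖x‖)|`. [folklore] -/
theorem norm_radialReparam_le (h : ℝ → ℝ) (x : 𝔻²) : ‖radialReparam h x‖ ≤ |h ‖(x : EuclideanSpace ℝ (Fin (1 + 1)))‖| := by
  by_cases hx : (x : EuclideanSpace ℝ (Fin (1 + 1))) = 0
  · rw [radialReparam, hx, smul_zero, norm_zero]; exact abs_nonneg _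
  · rw [norm_radialReparam hx]

/-- The reparametrised point lies in the disc when `|h| ≤ 1` on `[0, 1]`. [folklore] -/
theorem radialReparam_mem {h : ℝ → ℝ} (hb : ∀ r, 0 ≤ r → r ≤ 1 → |h r| ≤ 1) (x : 𝔻²) :
    radialReparam h x ∈ closedBall (0 : EuclideanSpace ℝ (Fin (1 + 1))) 1 :=
  mem_closedBall_zero_iff.mpr ((norm_radialReparam_le h x).trans (hb _ (norm_nonneg _) (mem_closedBall_zero_iff.mp x.2)))

/-- **Joint continuity of radial reparametrisations** for a jointly continuous profile vanishing
at `0` (continuity at the centre by the norm bound). [folklore] -/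
theorem continuous_radialReparam {Z : Type*} [TopologicalSpace Z] {h : Z → ℝ → ℝ}
    (hh : Continuous fun p : Z × ℝ => h p.1 p.2) (h0 : ∀ z, h z 0 = 0) :
    Continuous fun p : Z × 𝔻² => radialReparam (h p.1) p.2 := by
  have hval : Continuous fun p : Z × 𝔻² => ((p.2 : 𝔻²) : EuclideanSpace ℝ (Fin (1 + 1))) :=
    continuous_subtype_val.comp continuous_snd
  have hnorm : Continuous fun p : Z × 𝔻² => ‖((p.2 : 𝔻²) : EuclideanSpace ℝ (Fin (1 + 1)))‖ := hval.norm
  have hnum : Continuous fun p : Z × 𝔻² => h p.1 ‖((p.2 : 𝔻²) : EuclideanSpace ℝ (Fin (1 + 1)))‖ :=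
    hh.comp (continuous_fst.prodMk hnorm)
  rw [continuous_iff_continuousAt]
  rintro ⟨z, x⟩
  by_cases hx : (x : EuclideanSpace ℝ (Fin (1 + 1))) = 0
  · -- at the centre: the values are bounded in norm by `|h z ‖x‖| → 0`
    have hval0 : radialReparam (h z) x = 0 := by rw [radialReparam, hx, smul_zero]
    change Tendsto (fun p : Z × 𝔻² => radialReparam (h p.1) p.2) (𝓝 (z, x)) (𝓝 (radialReparam (h z) x))
    rw [hval0]
    have hb : Tendsto (fun p : Z × 𝔻² => |h p.1 ‖((p.2 : 𝔻²) : EuclideanSpace ℝ (Fin (1 + 1)))‖|) (𝓝 (z, x)) (𝓝 0) := by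
      have h1 : Continuous fun p : Z × 𝔻² => |h p.1 ‖((p.2 : 𝔻²) : EuclideanSpace ℝ (Fin (1 + 1)))‖| := continuous_abs.comp hnum
      have h2 := h1.continuousAt (x := (z, x))
      have h3 : |h z ‖(x : EuclideanSpace ℝ (Fin (1 + 1)))‖| = 0 := by rw [hx, norm_zero, h0, abs_zero]
      rw [ContinuousAt, h3] at h2
      exact h2
    exact squeeze_zero_norm (fun p : Z × 𝔻² => norm_radialReparam_le (h p.1) p.2) hb
  · -- off the centre the formula is continuous
    have hne : ∀ᶠ p : Z × 𝔻² in 𝓝 (z, x), ((p.2 : 𝔻²) : EuclideanSpace ℝ (Fin (1 + 1))) ≠ 0 :=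
      (hval.continuousAt (x := (z, x))).eventually_ne hx
    exact ((hnum.continuousAt.div hnorm.continuousAt (norm_ne_zero_iff.mpr hx)).smul hval.continuousAt)

/-- The reparametrisation on the boundary circle: `h(1) u`. [folklore] -/
theorem radialReparam_bd (h : ℝ → ℝ) (u : 𝕊¹) :
    radialReparam h (bd u) = h 1 • (u : EuclideanSpace ℝ (Fin (1 + 1))) := by
  have hu : ‖(u : EuclideanSpace ℝ (Fin (1 + 1)))‖ = 1 := norm_eq_of_mem_sphere u
  change (h ‖(u : EuclideanSpace ℝ (Fin (1 + 1)))‖ / ‖(u : EuclideanSpace ℝ (Fin (1 + 1)))‖) • (u : EuclideanSpace ℝ (Fin (1 + 1))) = _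
  rw [hu, div_one]

/-- The reparametrisation by the identity profile is the identity. [folklore] -/
theorem radialReparam_id (x : 𝔻²) : radialReparam id x = x := by
  by_cases hx : (x : EuclideanSpace ℝ (Fin (1 + 1))) = 0
  · rw [radialReparam, hx, smul_zero]
  · rw [radialReparam, id, div_self (norm_ne_zero_iff.mpr hx), one_smul]

end Reparam

/-! ### 3. Reading a disc along its circles -/

section DiscAnnulus

omit [ChartedSpace (𝔼 m) M] [IsManifold (𝓡 m) 1 M]

/-- The clamp of a real number to `[0, 1]`. [folklore] -/
def clamp01 (t : ℝ) : ℝ := max 0 (min 1 t)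

/-- The clamp is continuous. [folklore] -/
theorem continuous_clamp01 : Continuous clamp01 := continuous_const.max (continuous_const.min continuous_id)

/-- The clamp lies in `[0, 1]`. [folklore] -/
theorem clamp01_mem (t : ℝ) : 0 ≤ clamp01 t ∧ clamp01 t ≤ 1 :=
  ⟨le_max_left _ _, max_le zero_le_one (min_le_left _ _)⟩

/-- The clamp on `[0, 1]`. [folklore] -/
theorem clamp01_of_mem {t : ℝ} (h0 : 0 ≤ t) (h1 : t ≤ 1) : clamp01 t = t := by
  unfold clamp01; rw [min_eq_right h1, max_eq_right h0]

/-- The scaled boundary point `c • u` of the disc (`0 ≤ c ≤ 1` after clamping). [folklore] -/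
def scaleBd (c : ℝ) (u : 𝕊¹) : 𝔻² :=
  ⟨clamp01 c • (u : EuclideanSpace ℝ (Fin (1 + 1))), by
    rw [mem_closedBall_zero_iff, norm_smul, Real.norm_of_nonneg (clamp01_mem c).1, norm_eq_of_mem_sphere u, mul_one]
    exact (clamp01_mem c).2⟩

/-- The scaled boundary point is jointly continuous. [folklore] -/
theorem continuous_scaleBd : Continuous fun p : ℝ × 𝕊¹ => scaleBd p.1 p.2 :=
  ((continuous_clamp01.comp continuous_fst).smul (continuous_subtype_val.comp continuous_snd)).subtype_mk _

/-- At scale `1` the scaled boundary point is the boundary point. [folklore] -/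
@[simp] theorem scaleBd_one (u : 𝕊¹) : scaleBd 1 u = bd u := by
  apply Subtype.ext
  change clamp01 1 • (u : EuclideanSpace ℝ (Fin (1 + 1))) = u
  rw [clamp01_of_mem zero_le_one le_rfl, one_smul]

/-- At scale `0` the scaled boundary point is the centre. [folklore] -/
@[simp] theorem scaleBd_zero (u : 𝕊¹) : scaleBd 0 u = ctr := by
  apply Subtype.ext
  change clamp01 0 • (u : EuclideanSpace ℝ (Fin (1 + 1))) = (0 : EuclideanSpace ℝ (Fin (1 + 1)))
  rw [clamp01_of_mem le_rfl zero_le_one, zero_smul]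

/-- **The disc `Y` read along its circles from the boundary inward**: the annulus
`(t, u) ↦ Y((1 - t) u)` from `Y ∘ bd` to the constant circle `Y(centre)`. [folklore] -/
def discIn (Y : C(𝔻², M)) : C(ℝ × 𝕊¹, M) :=
  ⟨fun q => Y (scaleBd (1 - q.1) q.2), Y.continuous.comp (continuous_scaleBd.comp ((continuous_const.sub continuous_fst).prodMk continuous_snd))⟩

/-- `discIn Y` starts on the boundary values of `Y`. [folklore] -/
@[simp] theorem discIn_zero (Y : C(𝔻², M)) (u : 𝕊¹) : discIn Y (0, u) = Y (bd u) := by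
  change Y (scaleBd (1 - 0) u) = _; rw [sub_zero, scaleBd_one]

/-- `discIn Y` ends on the constant circle at the centre value. [folklore] -/
@[simp] theorem discIn_one (Y : C(𝔻², M)) (u : 𝕊¹) : discIn Y (1, u) = Y ctr := by
  change Y (scaleBd (1 - 1) u) = _; rw [sub_self, scaleBd_zero]

/-- **The disc read outward**: the reversal of `discIn`. [folklore] -/
def discOut (Y : C(𝔻², M)) : C(ℝ × 𝕊¹, M) := revA (discIn Y)

/-- `discOut Y` starts on the constant circle. [folklore] -/
@[simp] theorem discOut_zero (Y : C(𝔻², M)) (u : 𝕊¹) : discOut Y (0, u) = Y ctr := by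
  change discIn Y (1 - 0, u) = _; rw [sub_zero, discIn_one]

/-- `discOut Y` ends on the boundary values of `Y`. [folklore] -/
@[simp] theorem discOut_one (Y : C(𝔻², M)) (u : 𝕊¹) : discOut Y (1, u) = Y (bd u) := by
  change discIn Y (1 - 1, u) = _; rw [sub_self, discIn_zero]

end DiscAnnulus

/-! ### 4. Reading a disc inward and capping gives back its class -/

section ReadClass

omit [ChartedSpace (𝔼 m) M] [IsManifold (𝓡 m) 1 M] in
/-- **Inserting `discIn Y` in front of the constant disc is a radial reparametrisation of `Y`**
by the profile `r ↦ max 0 (2r - 1)`. [folklore] -/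
theorem insertDisc_discIn_constDisc_apply (Y : C(𝔻², M)) (x : 𝔻²) :
    insertDisc (discIn Y) (constDisc (Y ctr)) (fun u => discIn_one Y u) x =
      Y ⟨radialReparam (fun r => max 0 (2 * r - 1)) x, radialReparam_mem (fun r _ h1 => by
        rw [abs_le]; constructor <;> [exact le_trans (by norm_num) (le_max_left _ _); exact max_le zero_le_one (by linarith)]) x⟩ := by
  set r := ‖(x : EuclideanSpace ℝ (Fin (1 + 1)))‖ with hr
  change insertFun (discIn Y) (constDisc (Y ctr)) x = _
  by_cases h : r ≤ 2⁻¹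
  · rw [insertFun_of_le h]
    change Y ctr = Y _
    congr 1
    apply Subtype.ext
    change (0 : EuclideanSpace ℝ (Fin (1 + 1))) = radialReparam (fun r => max 0 (2 * r - 1)) x
    rw [radialReparam, ← hr, show max 0 (2 * r - 1) = 0 from max_eq_left (by linarith), zero_div, zero_smul]
  · push Not at h
    rw [insertFun_of_lt h]
    change Y (scaleBd (1 - (2 - 2 * r)) (dir2 x)) = Y _
    have hx : (x : EuclideanSpace ℝ (Fin (1 + 1))) ≠ 0 := by
      intro h0; rw [hr, h0, norm_zero] at h; norm_num at h
    have hr1 : r ≤ 1 := mem_closedBall_zero_iff.mp x.2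
    congr 1
    apply Subtype.ext
    change clamp01 (1 - (2 - 2 * r)) • ((dir2 x : 𝕊¹) : EuclideanSpace ℝ (Fin (1 + 1))) = radialReparam (fun r => max 0 (2 * r - 1)) x
    rw [dir2_val hx, radialReparam, ← hr, show max 0 (2 * r - 1) = 2 * r - 1 from max_eq_right (by linarith),
      show (1 : ℝ) - (2 - 2 * r) = 2 * r - 1 by ring, clamp01_of_mem (by linarith) (by linarith), smul_smul, div_eq_mul_inv]

/-- **Reading a disc inward and capping with the constant disc has the class of the disc**:
`e(F, insert (discIn Y) (const Y(centre))) = e(F, Y)`. [folklore] -/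
theorem eClass_insertDisc_discIn (hm : 2 ≤ m) {ε : 𝕊¹ → M} (Y : C(𝔻², M)) (hY : ∀ u, Y (bd u) = ε u)
    {F : 𝕊¹ → Fr m} (hF : IsStableFrameFieldOn ε F univ) :
    eClass (insertDisc (discIn Y) (constDisc (Y ctr)) fun u => discIn_one Y u) F
        (hF.congr_map fun u _ => by change insertDisc (discIn Y) _ _ (bd u) = ε u; rw [insertDisc_bd, discIn_zero, hY]) =
      eClass Y F (hF.congr_map fun u _ => hY u) := by
  -- the profiles `h_s = (1 - s) max(0, 2r - 1) + s r`
  set h : I → ℝ → ℝ := fun s r => (1 - (s : ℝ)) * max 0 (2 * r - 1) + (s : ℝ) * r with hh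
  have hhc : Continuous fun p : I × ℝ => h p.1 p.2 := by
    rw [hh]; dsimp only
    exact ((continuous_const.sub (continuous_subtype_val.comp continuous_fst)).mul
      (continuous_const.max ((continuous_const.mul continuous_snd).sub continuous_const))).add
      ((continuous_subtype_val.comp continuous_fst).mul continuous_snd)
  have hh0 : ∀ s, h s 0 = 0 := fun s => by
    rw [hh]
    show (1 - (s : ℝ)) * max 0 (2 * 0 - 1) + (s : ℝ) * 0 = 0
    rw [max_eq_left (by norm_num : (2 : ℝ) * 0 - 1 ≤ 0)]; ring
  have hh1 : ∀ s, h s 1 = 1 := fun s => by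
    rw [hh]
    show (1 - (s : ℝ)) * max 0 (2 * 1 - 1) + (s : ℝ) * 1 = 1
    rw [max_eq_right (by norm_num : (0 : ℝ) ≤ 2 * 1 - 1)]; ring
  have hb : ∀ (s : I) r, 0 ≤ r → r ≤ 1 → |h s r| ≤ 1 := fun s r h0 h1 => by
    have hs0 := s.2.1; have hs1 := s.2.2
    have hmx : 0 ≤ max 0 (2 * r - 1) ∧ max 0 (2 * r - 1) ≤ 1 := ⟨le_max_left _ _, max_le zero_le_one (by linarith)⟩
    rw [hh]; dsimp only
    rw [abs_le]; constructor <;> nlinarith [hmx.1, hmx.2]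
  set D : I → C(𝔻², M) := fun s => ⟨fun x => Y ⟨radialReparam (h s) x, radialReparam_mem (hb s) x⟩,
    Y.continuous.comp (((continuous_radialReparam (Z := I) hhc hh0).comp (continuous_const.prodMk continuous_id)).subtype_mk _)⟩
    with hD
  have hDc : Continuous fun p : I × 𝔻² => D p.1 p.2 :=
    Y.continuous.comp ((continuous_radialReparam (Z := I) hhc hh0).subtype_mk _)
  have hDbd : ∀ (s : I) u, D s (bd u) = ε u := fun s u => by
    change Y ⟨radialReparam (h s) (bd u), _⟩ = ε u
    rw [← hY]
    congr 1; apply Subtype.ext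
    change radialReparam (h s) (bd u) = u
    rw [radialReparam_bd, hh1, one_smul]
  have key := eClass_eq_of_family hm D hDc hDbd hF
  -- ends
  have e0 : D 0 = insertDisc (discIn Y) (constDisc (Y ctr)) fun u => discIn_one Y u := by
    ext x
    rw [insertDisc_discIn_constDisc_apply]
    change Y ⟨radialReparam (h 0) x, _⟩ = Y ⟨radialReparam (fun r => max 0 (2 * r - 1)) x, _⟩
    have hfun : h 0 = fun r => max 0 (2 * r - 1) := by
      funext r; rw [hh]; dsimp only; rw [show ((0 : I) : ℝ) = 0 from rfl]; ring
    congr 2; rw [hfun]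
  have e1 : D 1 = Y := by
    ext x
    change Y ⟨radialReparam (h 1) x, _⟩ = Y x
    congr 1; apply Subtype.ext
    change radialReparam (h 1) x = x
    have : h 1 = id := by funext r; rw [hh]; dsimp only; rw [show ((1 : I) : ℝ) = 1 from rfl]; simp
    rw [this]; exact radialReparam_id x
  rw [← eClass_congr_disc e0 (hF.congr_map fun u _ => hDbd 0 u), ← eClass_congr_disc e1 (hF.congr_map fun u _ => hDbd 1 u)]
  exact key

end ReadClass

/-! ### 5. Paths of constant circles -/

section PathAnnulus

omit [ChartedSpace (𝔼 m) M] [IsManifold (𝓡 m) 1 M] in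
/-- **The annulus of constant circles along a path** `p : ℝ → M`. [folklore] -/
def pathA (p : C(ℝ, M)) : C(ℝ × 𝕊¹, M) := ⟨fun q => p q.1, p.continuous.comp continuous_fst⟩

omit [ChartedSpace (𝔼 m) M] [IsManifold (𝓡 m) 1 M] in
/-- Values of the path annulus. [folklore] -/
@[simp] theorem pathA_apply (p : C(ℝ, M)) (t : ℝ) (u : 𝕊¹) : pathA p (t, u) = p t := rfl

/-- **Inserting a path of constant circles in front of the constant disc at its end has class `0`**
(for constant frames at both ends): the discs "along `p` up to time `s`, then constant" all bound
the constant circle `p(0)` and start from the constant disc. [folklore] -/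
theorem eClass_insertDisc_pathA (hm : 2 ≤ m) (p : C(ℝ, M)) {A : Fr m} (hA : LinearIndependent ℝ A) :
    eClass (insertDisc (pathA p) (constDisc (p 1)) fun u => rfl) (fun _ => A)
        ((isStableFrameFieldOn_constMap (p 0) hA univ).congr_map fun u _ => by
          change insertDisc (pathA p) _ _ (bd u) = p 0; rw [insertDisc_bd]; rfl) = 0 := by
  -- the family `s ↦ insert (path up to time s) (const p(s))`
  have hc : Continuous fun q : I × (ℝ × 𝕊¹) => p ((q.1 : ℝ) * q.2.1) :=
    p.continuous.comp ((continuous_subtype_val.comp continuous_fst).mul (continuous_fst.comp continuous_snd))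
  set Ps : I → C(ℝ, M) := fun s => ⟨fun t => p ((s : ℝ) * t), p.continuous.comp (continuous_const.mul continuous_id)⟩ with hPs
  set D : I → C(𝔻², M) := fun s => insertDisc (pathA (Ps s)) (constDisc (p s)) fun u => by
    change p ((s : ℝ) * 1) = p s; rw [mul_one] with hD
  have hDc : Continuous fun q : I × 𝔻² => D q.1 q.2 :=
    continuous_insertFun (Z := I) (A := fun s => pathA (Ps s)) (X := fun s => constDisc (p s)) hc
      (p.continuous.comp (continuous_subtype_val.comp continuous_fst)) fun s u => by
        change p ((s : ℝ) * 1) = p s; rw [mul_one]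
  have hDbd : ∀ (s : I) u, D s (bd u) = p 0 := fun s u => by
    rw [hD]; dsimp only; rw [insertDisc_bd]; change p ((s : ℝ) * 0) = p 0; rw [mul_zero]
  have key := eClass_eq_of_family hm D hDc hDbd (isStableFrameFieldOn_constMap (p 0) hA univ)
  -- `s = 0`: the constant disc
  have e0 : D 0 = constDisc (p 0) := by
    ext x
    change insertFun (pathA (Ps 0)) (constDisc (p 0)) x = p 0
    unfold insertFun
    split_ifs
    · rfl
    · change p (((0 : I) : ℝ) * _) = p 0; rw [show ((0 : I) : ℝ) = 0 from rfl, zero_mul]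
  -- `s = 1`: the given disc
  have e1 : D 1 = insertDisc (pathA p) (constDisc (p 1)) fun u => rfl := by
    have hP1 : pathA (Ps 1) = pathA p := by
      ext q; change p (((1 : I) : ℝ) * q.1) = p q.1; rw [show ((1 : I) : ℝ) = 1 from rfl, one_mul]
    have : ∀ (A₁ A₂ : C(ℝ × 𝕊¹, M)) (h₁ : ∀ u, A₁ (1, u) = constDisc (p 1) (bd u)) (h₂ : ∀ u, A₂ (1, u) = constDisc (p 1) (bd u)),
        A₁ = A₂ → insertDisc A₁ (constDisc (p 1)) h₁ = insertDisc A₂ (constDisc (p 1)) h₂ := by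
      intros A₁ A₂ h₁ h₂ e; subst e; rfl
    rw [hD]; dsimp only
    have h1c : constDisc (p (1 : I)) = constDisc (p 1) := rfl
    exact this _ _ _ _ hP1
  rw [← eClass_congr_disc e1 ((isStableFrameFieldOn_constMap (p 0) hA univ).congr_map fun u _ => hDbd 1 u), ← key,
    eClass_congr_disc e0 _ (isStableFrameFieldOn_constMap (p 0) hA univ)]
  exact eClass_constDisc hm (p 0) hA

end PathAnnulus

/-! ### 6. The loop of circles through a sphere, based at its equator -/

section SphereLoop

/-- **The loop of circles reading a `2`-sphere map from its equator**: inward through the upper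
hemisphere disc to the value at the north pole, along a path to the value at the south pole, and
outward through the lower hemisphere disc back to the equator. [folklore] -/
def sphereLoop (g : C(𝕊², M)) (p : C(ℝ, M)) (hp0 : p 0 = discUp g ctr) (hp1 : p 1 = discDown g ctr) : C(ℝ × 𝕊¹, M) :=
  concatA (discIn (discUp g)) (concatA (pathA p) (discOut (discDown g)) fun u => by rw [pathA_apply, hp1, discOut_zero])
    fun u => by rw [discIn_one, concatA_zero, pathA_apply, hp0]

omit [IsManifold (𝓡 m) 1 M] in
/-- The sphere loop starts on the equator. [folklore] -/
theorem sphereLoop_zero (g : C(𝕊², M)) (p : C(ℝ, M)) (hp0 : p 0 = discUp g ctr) (hp1 : p 1 = discDown g ctr) (u : 𝕊¹) :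
    sphereLoop g p hp0 hp1 (0, u) = g (equator u) := by
  unfold sphereLoop; rw [concatA_zero, discIn_zero]; exact discUp_bd g u

omit [IsManifold (𝓡 m) 1 M] in
/-- The sphere loop ends on the equator. [folklore] -/
theorem sphereLoop_one (g : C(𝕊², M)) (p : C(ℝ, M)) (hp0 : p 0 = discUp g ctr) (hp1 : p 1 = discDown g ctr) (u : 𝕊¹) :
    sphereLoop g p hp0 hp1 (1, u) = g (equator u) := by
  unfold sphereLoop; rw [concatA_one, concatA_one, discOut_one]; exact discDown_bd g u

/-- **The class inserted by the sphere loop is the sum of the two hemisphere classes**: for a disc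
`X` bounding the equator circle `ε = g ∘ equator` and a frame `Fε` along it,
`e(Fε, insert (sphereLoop g) X) + e(Fε, X) = e(Fε, discUp g) + e(Fε, discDown g)`. [folklore] -/
theorem eClass_insertDisc_sphereLoop_add (hm : 2 ≤ m) (g : C(𝕊², M)) (p : C(ℝ, M)) (hp0 : p 0 = discUp g ctr)
    (hp1 : p 1 = discDown g ctr) (X : C(𝔻², M)) (hX : ∀ u, X (bd u) = g (equator u))
    {Fε : 𝕊¹ → Fr m} (hFε : IsStableFrameFieldOn (g ∘ equator) Fε univ) :
    eClass (insertDisc (sphereLoop g p hp0 hp1) X fun u => (sphereLoop_one g p hp0 hp1 u).trans (hX u).symm) Fε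
        (hFε.congr_map fun u _ => by
          change insertDisc (sphereLoop g p hp0 hp1) X _ (bd u) = g (equator u); rw [insertDisc_bd, sphereLoop_zero]) +
      eClass X Fε (hFε.congr_map fun u _ => hX u) =
    eClass (discUp g) Fε (hFε.congr_map fun u _ => discUp_bd g u) + eClass (discDown g) Fε (hFε.congr_map fun u _ => discDown_bd g u) := by
  set U := discUp g with hU
  set L := discDown g with hL
  have hUbd : ∀ u, U (bd u) = g (equator u) := discUp_bd g
  have hLbd : ∀ u, L (bd u) = g (equator u) := discDown_bd g
  -- constant frames at the two poles
  set A : Fr m := ⇑(stdB m) with hAdef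
  have hA : LinearIndependent ℝ A := (stdB m).linearIndependent
  have hFN := isStableFrameFieldOn_constMap (X := 𝕊¹) (U ctr) hA univ
  have hFS := isStableFrameFieldOn_constMap (X := 𝕊¹) (L ctr) hA univ
  -- the inner annulus `path ⋆ discOut L` and the disc behind `discIn U`
  have hPL : ∀ u, pathA p (1, u) = discOut L (0, u) := fun u => by rw [pathA_apply, hp1, discOut_zero]
  set W : C(𝔻², M) := insertDisc (concatA (pathA p) (discOut L) hPL) X fun u =>
    (concatA_one _ _ hPL u).trans ((discOut_one L u).trans ((hLbd u).trans (hX u).symm)) with hW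
  have hWbd : ∀ u, W (bd u) = U ctr := fun u => by
    rw [hW, insertDisc_bd, concatA_zero, pathA_apply, hp0]
  -- (1) split off `discIn U`: `e(ins Λ X) = e(ins (discIn U) W)`
  have h1 : eClass (insertDisc (sphereLoop g p hp0 hp1) X fun u => (sphereLoop_one g p hp0 hp1 u).trans (hX u).symm) Fε
      (hFε.congr_map fun u _ => by
        change insertDisc (sphereLoop g p hp0 hp1) X _ (bd u) = g (equator u); rw [insertDisc_bd, sphereLoop_zero]) =
      eClass (insertDisc (discIn U) W fun u => (discIn_one U u).trans (hWbd u).symm) Fε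
        (hFε.congr_map fun u _ => by change insertDisc (discIn U) W _ (bd u) = g (equator u); rw [insertDisc_bd, discIn_zero, hUbd]) :=
    eClass_insertDisc_concatA hm (α := g ∘ equator) (discIn U) (concatA (pathA p) (discOut L) hPL) (fun u => by
      rw [discIn_zero, hUbd]; rfl) (fun u => by rw [discIn_one, concatA_zero, pathA_apply, hp0]) X
      (fun u => (concatA_one _ _ hPL u).trans ((discOut_one L u).trans ((hLbd u).trans (hX u).symm))) hFε
  -- (2) along `discIn U`: `e(Fε, ins (discIn U) W) + e(F_N, W) = e(Fε, U) + 0`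
  have h2 := eClass_insertDisc_add_eClass_path hm (α := g ∘ equator) (β := fun _ => U ctr) (discIn U)
    (fun u => by rw [discIn_zero, hUbd]; rfl) (fun u => discIn_one U u) W (constDisc (U ctr)) hWbd (fun _ => rfl) hFε hFN
  have h2' : eClass (insertDisc (discIn U) (constDisc (U ctr)) fun u => discIn_one U u) Fε _ = eClass U Fε _ :=
    eClass_insertDisc_discIn hm U hUbd hFε
  have h2'' : eClass (constDisc (U ctr)) (fun _ => A) _ = 0 := eClass_constDisc hm (U ctr) hA
  -- (3) split `W`: `e(F_N, W) = e(F_N, ins (pathA p) W')`, `W' = ins (discOut L) X`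
  set W' : C(𝔻², M) := insertDisc (discOut L) X fun u => (discOut_one L u).trans ((hLbd u).trans (hX u).symm) with hW'
  have hW'bd : ∀ u, W' (bd u) = L ctr := fun u => by rw [hW', insertDisc_bd, discOut_zero]
  have h3 : eClass W (fun _ => A) (hFN.congr_map fun u _ => hWbd u) =
      eClass (insertDisc (pathA p) W' fun u => (pathA_apply p 1 u).trans (hp1.trans (hW'bd u).symm)) (fun _ => A)
        (hFN.congr_map fun u _ => by change insertDisc (pathA p) W' _ (bd u) = U ctr; rw [insertDisc_bd, pathA_apply, hp0]) :=
    eClass_insertDisc_concatA hm (α := fun _ => U ctr) (pathA p) (discOut L) (fun u => by rw [pathA_apply, hp0]) hPL X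
      (fun u => (discOut_one L u).trans ((hLbd u).trans (hX u).symm)) hFN
  -- (4) along the path: `e(F_N, ins (pathA p) W') + e(F_S, W') = 0 + 0`
  have h4 := eClass_insertDisc_add_eClass_path hm (α := fun _ => U ctr) (β := fun _ => L ctr) (pathA p)
    (fun u => by rw [pathA_apply, hp0]) (fun u => by rw [pathA_apply, hp1]) W' (constDisc (L ctr)) hW'bd (fun _ => rfl) hFN hFS
  have h4' : eClass (insertDisc (pathA p) (constDisc (L ctr)) fun u => by rw [pathA_apply, hp1]; rfl) (fun _ => A)
      (hFN.congr_map fun u _ => (insertDisc_bd (pathA p) (constDisc (L ctr)) _ u).trans hp0) = 0 := by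
    have base := eClass_insertDisc_pathA hm p hA
    have e : insertDisc (pathA p) (constDisc (p 1)) (fun u => rfl) = insertDisc (pathA p) (constDisc (L ctr))
        (fun u => by rw [pathA_apply, hp1]; rfl) := by
      have : ∀ (x y : M) (exy : x = y) (h₁ : ∀ u, pathA p (1, u) = constDisc x (bd u)) (h₂ : ∀ u, pathA p (1, u) = constDisc y (bd u)),
          insertDisc (pathA p) (constDisc x) h₁ = insertDisc (pathA p) (constDisc y) h₂ := by
        intros x y exy h₁ h₂; subst exy; rfl
      exact this _ _ hp1 _ _
    have brid := eClass_congr_disc e ((isStableFrameFieldOn_constMap (p 0) hA univ).congr_map fun u _ => by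
      change insertDisc (pathA p) _ _ (bd u) = p 0; rw [insertDisc_bd]; rfl)
      (hFN.congr_map fun u _ => (insertDisc_bd (pathA p) (constDisc (L ctr)) _ u).trans hp0)
    exact brid.symm.trans base
  have h4'' : eClass (constDisc (L ctr)) (fun _ => A) _ = 0 := eClass_constDisc hm (L ctr) hA
  -- (5) along `discOut L = revA (discIn L)`: `e(F_S, ins (discOut L) X) + e(Fε, X) = e(Fε, ins (discIn L) c_S) + e(F_S, c_S)`
  have h5 := eClass_insertDisc_revA_add hm (α := g ∘ equator) (β := fun _ => L ctr) (discIn L)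
    (fun u => by rw [discIn_zero, hLbd]; rfl) (fun u => discIn_one L u) X (constDisc (L ctr)) hX (fun _ => rfl) hFε hFS
  have h5' : eClass (insertDisc (discIn L) (constDisc (L ctr)) fun u => discIn_one L u) Fε _ = eClass L Fε _ :=
    eClass_insertDisc_discIn hm L hLbd hFε
  -- assemble in `ZMod 2` (no rewriting inside the class terms)
  have hW'eq : eClass (insertDisc (revA (discIn L)) X fun u => by rw [revA_apply, sub_self, discIn_zero, hLbd, hX]) (fun _ => A)
      (hFS.congr_map fun u _ => by
        change insertDisc (revA (discIn L)) X _ (bd u) = L ctr; rw [insertDisc_bd, revA_apply, sub_zero, discIn_one]) =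
      eClass W' (fun _ => A) (hFS.congr_map fun u _ => hW'bd u) := rfl
  have stepA : ∀ a b w b0 c0 u pw : ZMod 2, a = b → b + w = b0 + c0 → b0 = u → c0 = 0 → w = pw → a = u + pw := by decide
  have eA := stepA _ _ _ _ _ _ _ h1 h2 h2' h2'' h3
  have stepB₁ : ∀ pw w' p0 cS : ZMod 2, pw + w' = p0 + cS → p0 = 0 → cS = 0 → pw = w' := by decide
  have eB₁ := stepB₁ _ _ _ _ h4 h4' h4''
  have stepB₂ : ∀ cS rv w' li l x : ZMod 2, cS = 0 → rv = w' → li + cS = rv + x → li = l → w' = l + x := by decide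
  have eB := eB₁.trans (stepB₂ _ _ _ _ _ _ h4'' hW'eq h5 h5')
  have stepC : ∀ a u pw l x : ZMod 2, a = u + pw → pw = l + x → a + x = u + l := by decide
  exact stepC _ _ _ _ _ eA eB

end SphereLoop

/-! ### 7. Conjugating a loop of circles by an annulus -/

section Conj

omit [ChartedSpace (𝔼 m) M] [IsManifold (𝓡 m) 1 M] in
/-- Double reversal of an annulus. [folklore] -/
@[simp] theorem revA_revA (R : C(ℝ × 𝕊¹, M)) : revA (revA R) = R := by
  ext q; change R (1 - (1 - q.1), q.2) = R q; rw [sub_sub_cancel]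

/-- **Loops of circles: the inserted class difference does not depend on the disc**:
for a loop `Λ` at `β` (an annulus from `β` to `β`) and discs `W, W'` bounding `β`,
`e(ins Λ W) + e(W) = e(ins Λ W') + e(W')`. [folklore] -/
theorem eClass_insertDisc_loop_add (hm : 2 ≤ m) {β : 𝕊¹ → M} (Λ : C(ℝ × 𝕊¹, M)) (h0 : ∀ u, Λ (0, u) = β u)
    (h1 : ∀ u, Λ (1, u) = β u) (W W' : C(𝔻², M)) (hW : ∀ u, W (bd u) = β u) (hW' : ∀ u, W' (bd u) = β u)
    {F : 𝕊¹ → Fr m} (hF : IsStableFrameFieldOn β F univ) :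
    eClass (insertDisc Λ W fun u => (h1 u).trans (hW u).symm) F
        (hF.congr_map fun u _ => by change insertDisc Λ W _ (bd u) = β u; rw [insertDisc_bd, h0]) +
      eClass W F (hF.congr_map fun u _ => hW u) =
    eClass (insertDisc Λ W' fun u => (h1 u).trans (hW' u).symm) F
        (hF.congr_map fun u _ => by change insertDisc Λ W' _ (bd u) = β u; rw [insertDisc_bd, h0]) +
      eClass W' F (hF.congr_map fun u _ => hW' u) :=
  eClass_insertDisc_add_eClass_path hm Λ h0 h1 W W' hW hW' hF hF

/-- **Conjugation**: for an annulus `R` from `α` to `β`, a loop `Λ` at `β`, a disc `X` bounding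
`α` and a disc `W` bounding `β`,
`e(Fα, ins (R ⋆ (Λ ⋆ R̄)) X) + e(Fα, X) = e(Fβ, ins Λ W) + e(Fβ, W)`. [folklore] -/
theorem eClass_insertDisc_conj_add (hm : 2 ≤ m) {α β : 𝕊¹ → M} (R : C(ℝ × 𝕊¹, M)) (hR0 : ∀ u, R (0, u) = α u)
    (hR1 : ∀ u, R (1, u) = β u) (Λ : C(ℝ × 𝕊¹, M)) (h0 : ∀ u, Λ (0, u) = β u) (h1 : ∀ u, Λ (1, u) = β u)
    (X W : C(𝔻², M)) (hX : ∀ u, X (bd u) = α u) (hW : ∀ u, W (bd u) = β u)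
    {Fα Fβ : 𝕊¹ → Fr m} (hFα : IsStableFrameFieldOn α Fα univ) (hFβ : IsStableFrameFieldOn β Fβ univ)
    (hΛR : ∀ u, Λ (1, u) = revA R (0, u)) (hRΛ : ∀ u, R (1, u) = concatA Λ (revA R) hΛR (0, u))
    (hend : ∀ u, concatA R (concatA Λ (revA R) hΛR) hRΛ (1, u) = X (bd u)) :
    eClass (insertDisc (concatA R (concatA Λ (revA R) hΛR) hRΛ) X hend) Fα
        (hFα.congr_map fun u _ => by change insertDisc _ X _ (bd u) = α u; rw [insertDisc_bd, concatA_zero, hR0]) +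
      eClass X Fα (hFα.congr_map fun u _ => hX u) =
    eClass (insertDisc Λ W fun u => (h1 u).trans (hW u).symm) Fβ
        (hFβ.congr_map fun u _ => by change insertDisc Λ W _ (bd u) = β u; rw [insertDisc_bd, h0]) +
      eClass W Fβ (hFβ.congr_map fun u _ => hW u) := by
  -- the discs behind `R` and behind `Λ`
  have hRX : ∀ u, revA R (1, u) = X (bd u) := fun u => by rw [revA_apply, sub_self, hR0, hX]
  set X₁ : C(𝔻², M) := insertDisc (revA R) X hRX with hX₁
  have hX₁bd : ∀ u, X₁ (bd u) = β u := fun u => by rw [hX₁, insertDisc_bd, revA_apply, sub_zero, hR1]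
  set W₁ : C(𝔻², M) := insertDisc (concatA Λ (revA R) hΛR) X fun u => (concatA_one _ _ hΛR u).trans (hRX u) with hW₁
  have hW₁bd : ∀ u, W₁ (bd u) = β u := fun u => by rw [hW₁, insertDisc_bd, concatA_zero, h0]
  -- (1) `e(ins (R ⋆ (Λ ⋆ R̄)) X) = e(ins R W₁)`
  have e1 := eClass_insertDisc_concatA hm (α := α) R (concatA Λ (revA R) hΛR) hR0 hRΛ X
    (fun u => (concatA_one _ _ hΛR u).trans (hRX u)) hFα
  -- (2) path additivity along `R`: compare `W₁` with `X₁`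
  have e2 := eClass_insertDisc_add_eClass_path hm (α := α) (β := β) R hR0 hR1 W₁ X₁ hW₁bd hX₁bd hFα hFβ
  -- (3) back and forth: `e(Fα, ins R X₁) = e(Fα, X)`
  have e3 := eClass_insertDisc_insertDisc_revA hm (α := α) R hR0 X hX hFα
  -- (4) `e(Fβ, W₁) = e(Fβ, ins Λ X₁)`
  have e4 := eClass_insertDisc_concatA hm (α := β) Λ (revA R) h0 hΛR X hRX hFβ
  -- (5) loop additivity: `e(ins Λ X₁) + e(X₁) = e(ins Λ W) + e(W)`
  have e5 := eClass_insertDisc_loop_add hm (β := β) Λ h0 h1 X₁ W hX₁bd hW hFβ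
  -- types of the intermediate classes agree definitionally; assemble in `ZMod 2`
  have eW₁ : eClass W₁ Fβ (hFβ.congr_map fun u _ => hW₁bd u) =
      eClass (insertDisc Λ X₁ fun u => (h1 u).trans (hX₁bd u).symm) Fβ
        (hFβ.congr_map fun u _ => by change insertDisc Λ X₁ _ (bd u) = β u; rw [insertDisc_bd, h0]) := e4
  have eRX₁ : eClass (insertDisc R X₁ fun u => (hR1 u).trans (hX₁bd u).symm) Fα
      (hFα.congr_map fun u _ => by change insertDisc R X₁ _ (bd u) = α u; rw [insertDisc_bd, hR0]) =
      eClass X Fα (hFα.congr_map fun u _ => hX u) := e3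
  have eTop : eClass (insertDisc (concatA R (concatA Λ (revA R) hΛR) hRΛ) X hend) Fα
      (hFα.congr_map fun u _ => by change insertDisc _ X _ (bd u) = α u; rw [insertDisc_bd, concatA_zero, hR0]) =
      eClass (insertDisc R W₁ fun u => (hR1 u).trans (hW₁bd u).symm) Fα
        (hFα.congr_map fun u _ => by change insertDisc R W₁ _ (bd u) = α u; rw [insertDisc_bd, hR0]) := e1
  rw [eTop]
  rw [eRX₁, eW₁] at e2
  -- e2 : e(ins R W₁) + e(ins Λ X₁) = e(X) + e(X₁);  e5 : e(ins Λ X₁) + e(X₁) = e(ins Λ W) + e(W)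
  have : ∀ a b c d e f : ZMod 2, a + b = c + d → b + d = e + f → a + c = e + f := by decide
  exact this _ _ _ _ _ _ e2 e5

end Conj

/-! ### 8. The drag loop of a circle around a sphere -/

section Drag

/-- **The drag loop** of the circle `γ = D ∘ bd` around the sphere `g`: inward through `D` to the
point `D(centre)`, along `p₀` to the north-pole value of `g`, outward through the upper hemisphere
disc to the equator, around the sphere loop, and all the way back. [folklore] -/
def dragLoop (D : C(𝔻², M)) (g : C(𝕊², M)) (p₀ p : C(ℝ, M)) (hp₀0 : p₀ 0 = D ctr) (hp₀1 : p₀ 1 = discUp g ctr)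
    (hp0 : p 0 = discUp g ctr) (hp1 : p 1 = discDown g ctr) : C(ℝ × 𝕊¹, M) :=
  let R : C(ℝ × 𝕊¹, M) := concatA (discIn D) (concatA (pathA p₀) (discOut (discUp g)) fun u => by
      rw [pathA_apply, hp₀1, discOut_zero]) fun u => by rw [discIn_one, concatA_zero, pathA_apply, hp₀0]
  let Λ : C(ℝ × 𝕊¹, M) := sphereLoop g p hp0 hp1
  have hΛR : ∀ u, Λ (1, u) = revA R (0, u) := fun u => by
    change sphereLoop g p hp0 hp1 (1, u) = R (1 - 0, u)
    rw [sphereLoop_one, sub_zero]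
    change _ = concatA (discIn D) _ _ (1, u)
    rw [concatA_one, concatA_one, discOut_one]; exact (discUp_bd g u).symm
  concatA R (concatA Λ (revA R) hΛR) fun u => by
    change concatA (discIn D) _ _ (1, u) = concatA Λ (revA R) hΛR (0, u)
    rw [concatA_zero, concatA_one, concatA_one, discOut_one]
    change _ = sphereLoop g p hp0 hp1 (0, u)
    rw [sphereLoop_zero]; exact discUp_bd g u

omit [IsManifold (𝓡 m) 1 M] in
/-- The drag loop starts on `γ = D ∘ bd`. [folklore] -/
theorem dragLoop_zero (D : C(𝔻², M)) (g : C(𝕊², M)) (p₀ p : C(ℝ, M)) (hp₀0 : p₀ 0 = D ctr) (hp₀1 : p₀ 1 = discUp g ctr)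
    (hp0 : p 0 = discUp g ctr) (hp1 : p 1 = discDown g ctr) (u : 𝕊¹) :
    dragLoop D g p₀ p hp₀0 hp₀1 hp0 hp1 (0, u) = D (bd u) := by
  unfold dragLoop; dsimp only; rw [concatA_zero, concatA_zero, discIn_zero]

omit [IsManifold (𝓡 m) 1 M] in
/-- The drag loop ends on `γ = D ∘ bd`. [folklore] -/
theorem dragLoop_one (D : C(𝔻², M)) (g : C(𝕊², M)) (p₀ p : C(ℝ, M)) (hp₀0 : p₀ 0 = D ctr) (hp₀1 : p₀ 1 = discUp g ctr)
    (hp0 : p 0 = discUp g ctr) (hp1 : p 1 = discDown g ctr) (u : 𝕊¹) :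
    dragLoop D g p₀ p hp₀0 hp₀1 hp0 hp1 (1, u) = D (bd u) := by
  unfold dragLoop; dsimp only
  rw [concatA_one, concatA_one, revA_apply, sub_self, concatA_zero, discIn_zero]

/-- **The class inserted by the drag loop**: for a frame `F` along `γ = D ∘ bd` and a frame `Fε`
along the equator circle of `g`,
`e(F, ins (dragLoop) D) + e(F, D) = e(Fε, discUp g) + e(Fε, discDown g)`. [folklore] -/
theorem eClass_insertDisc_dragLoop_add (hm : 2 ≤ m) (D : C(𝔻², M)) (g : C(𝕊², M)) (p₀ p : C(ℝ, M))
    (hp₀0 : p₀ 0 = D ctr) (hp₀1 : p₀ 1 = discUp g ctr) (hp0 : p 0 = discUp g ctr) (hp1 : p 1 = discDown g ctr)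
    {F : 𝕊¹ → Fr m} (hF : IsStableFrameFieldOn (D ∘ bd) F univ)
    {Fε : 𝕊¹ → Fr m} (hFε : IsStableFrameFieldOn (g ∘ equator) Fε univ) :
    eClass (insertDisc (dragLoop D g p₀ p hp₀0 hp₀1 hp0 hp1) D fun u => dragLoop_one D g p₀ p hp₀0 hp₀1 hp0 hp1 u) F
        (hF.congr_map fun u _ => by
          change insertDisc _ D _ (bd u) = D (bd u); rw [insertDisc_bd, dragLoop_zero]) +
      eClass D F hF =
    eClass (discUp g) Fε (hFε.congr_map fun u _ => discUp_bd g u) + eClass (discDown g) Fε (hFε.congr_map fun u _ => discDown_bd g u) := by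
  have hPU : ∀ u, pathA p₀ (1, u) = discOut (discUp g) (0, u) := fun u => by rw [pathA_apply, hp₀1, discOut_zero]
  set R : C(ℝ × 𝕊¹, M) := concatA (discIn D) (concatA (pathA p₀) (discOut (discUp g)) hPU) fun u => by
    rw [discIn_one, concatA_zero, pathA_apply, hp₀0] with hR
  have hR0 : ∀ u, R (0, u) = D (bd u) := fun u => by rw [hR, concatA_zero, discIn_zero]
  have hR1 : ∀ u, R (1, u) = g (equator u) := fun u => by rw [hR, concatA_one, concatA_one, discOut_one]; exact discUp_bd g u
  have key := eClass_insertDisc_conj_add hm (α := D ∘ bd) (β := g ∘ equator) R hR0 hR1 (sphereLoop g p hp0 hp1)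
    (sphereLoop_zero g p hp0 hp1) (sphereLoop_one g p hp0 hp1) D (discUp g) (fun u => rfl) (discUp_bd g) hF hFε
    (fun u => by rw [sphereLoop_one, revA_apply, sub_zero, hR1])
    (fun u => by rw [concatA_zero, sphereLoop_zero, hR1])
    (fun u => by rw [concatA_one, concatA_one, revA_apply, sub_self, hR0])
  have hsl := eClass_insertDisc_sphereLoop_add hm g p hp0 hp1 (discUp g) (discUp_bd g) hFε
  have hΛR : ∀ u, sphereLoop g p hp0 hp1 (1, u) = revA R (0, u) := fun u => by rw [sphereLoop_one, revA_apply, sub_zero, hR1]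
  have hRΛ : ∀ u, R (1, u) = concatA (sphereLoop g p hp0 hp1) (revA R) hΛR (0, u) := fun u => by
    rw [concatA_zero, sphereLoop_zero, hR1]
  have hend : ∀ u, concatA R (concatA (sphereLoop g p hp0 hp1) (revA R) hΛR) hRΛ (1, u) = D (bd u) := fun u => by
    rw [concatA_one, concatA_one, revA_apply, sub_self, hR0]
  have hdl : dragLoop D g p₀ p hp₀0 hp₀1 hp0 hp1 = concatA R (concatA (sphereLoop g p hp0 hp1) (revA R) hΛR) hRΛ := rfl
  have hdisc : insertDisc (dragLoop D g p₀ p hp₀0 hp₀1 hp0 hp1) D (fun u => dragLoop_one D g p₀ p hp₀0 hp₀1 hp0 hp1 u) =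
      insertDisc (concatA R (concatA (sphereLoop g p hp0 hp1) (revA R) hΛR) hRΛ) D hend := by
    have : ∀ (A₁ A₂ : C(ℝ × 𝕊¹, M)) (h₁ : ∀ u, A₁ (1, u) = D (bd u)) (h₂ : ∀ u, A₂ (1, u) = D (bd u)),
        A₁ = A₂ → insertDisc A₁ D h₁ = insertDisc A₂ D h₂ := by
      intros A₁ A₂ h₁ h₂ e; subst e; rfl
    exact this _ _ _ _ hdl
  have eTop := eClass_congr_disc hdisc (F := F) (hF.congr_map fun u _ => by
    change insertDisc _ D _ (bd u) = D (bd u); rw [insertDisc_bd, dragLoop_zero])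
    (hF.congr_map fun u _ => by change insertDisc _ D _ (bd u) = D (bd u); rw [insertDisc_bd, concatA_zero, hR0])
  have stepD : ∀ a a' d s u l : ZMod 2, a = a' → a' + d = s + u → s + u = u + l → a + d = u + l := by decide
  exact stepD _ _ _ _ _ _ eTop key hsl

/-- **Dragging around an odd sphere changes the class**: if `g` carries no stable tangent framing,
then `e(F, ins (dragLoop) D) ≠ e(F, D)`. [folklore] -/
theorem eClass_insertDisc_dragLoop_ne (hm : 2 ≤ m) (D : C(𝔻², M)) (g : C(𝕊², M)) (p₀ p : C(ℝ, M))
    (hp₀0 : p₀ 0 = D ctr) (hp₀1 : p₀ 1 = discUp g ctr) (hp0 : p 0 = discUp g ctr) (hp1 : p 1 = discDown g ctr)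
    {F : 𝕊¹ → Fr m} (hF : IsStableFrameFieldOn (D ∘ bd) F univ)
    (hg : ¬ HasStableTangentFramingAlong (𝓡 m) M g) :
    eClass (insertDisc (dragLoop D g p₀ p hp₀0 hp₀1 hp0 hp1) D fun u => dragLoop_one D g p₀ p hp₀0 hp₀1 hp0 hp1 u) F
        (hF.congr_map fun u _ => by
          change insertDisc _ D _ (bd u) = D (bd u); rw [insertDisc_bd, dragLoop_zero]) ≠
      eClass D F hF := by
  obtain ⟨Fε, hFε⟩ := exists_frame_equator (m := m) g
  have hadd := eClass_insertDisc_dragLoop_add hm D g p₀ p hp₀0 hp₀1 hp0 hp1 hF hFε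
  have hne : eClass (discUp g) Fε (hFε.congr_map fun u _ => discUp_bd g u) ≠
      eClass (discDown g) Fε (hFε.congr_map fun u _ => discDown_bd g u) := by
    intro h
    exact hg ((framed_iff_eClass_eq hm g hFε).mpr h)
  intro h
  apply hne
  have : ∀ a b c d : ZMod 2, a + b = c + d → a = b → c = d := by decide
  exact this _ _ _ _ hadd h

end Drag

end StableFrames

end Literature.Topology.FourManifolds
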